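import Mathlib.Probability.Distributions.Poisson.Basic
import Mathlib.Probability.Independence.Basic
import Mathlib.Data.Set.Card
import HarnessLib

/-!
# Poisson processes as random countable sets ("Poisson clouds") with a general mean measure

J. F. C. Kingman, *Poisson Processes*, Oxford Studies in Probability 3 (1993), §2.1, defines a
Poisson process on a measurable state space `S` as "a random countable subset `Π` of `S`" such
that, with `N(A) = #{Π ∩ A}`, (i) for disjoint measurable `A₁, …, Aₙ` the random variables
`N(A₁), …, N(Aₙ)` are independent, and (ii) `N(A)` has the Poisson distribution `𝒫(μ(A))`,
`μ = 𝔼N` the mean measure (with the conventions `𝒫(0) = δ₀` and `𝒫(∞)`: `N = ∞` a.s.).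

The tree's `Literature.Analysis.FunctionSpaces.IsPoissonPointProcess ν P` (file
`Analysis/FunctionSpaces/PoissonPointProcess`) is this notion for laws on LOCALLY FINITE
configurations of a TOPOLOGICAL space (the Lorentz-gas use case). Poisson clouds of random SETS
with an infinite, merely s-finite mean measure and no topology on the state space — the Poisson
point process of Brownian bubbles `X` on `Ω_b × [0, ∞)` with mean `λ μ × dt` of
Lawler–Schramm–Werner, *Conformal restriction: the chordal case* (2003), §7.2, whose bubbles
accumulate (the bubble measure `μ` is infinite) — do not fit there. This file gives Kingman's
definition verbatim for a random countable set `X : Ω → Set E` on a probability space: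

* `Literature.Probability.Process.IsPoissonCloud Λ X P` — `X ω` is countable, the counts
  `N(s) = (X ω ∩ s).encard ∈ ℕ∞` are measurable, `N(s) ~ Poisson(Λ s)` for measurable `s` with
  `Λ s < ∞`, `N(s) = ∞` a.s. when `Λ s = ∞` (Kingman's `𝒫(∞)`), and counts of finitely many
  pairwise disjoint measurable sets are independent;
* PROVED: `IsPoissonCloud.measure_inter_eq_empty` — the **avoidance probability**
  `P[X ∩ s = ∅] = e^{−Λ(s)}` for `Λ s < ∞` (Kingman §2.1: "`P{N(A) = 0} = e^{−μ(A)}`"), and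
  `IsPoissonCloud.measure_eq_empty_eq_zero` — a cloud whose mean measure has measurable sets of
  arbitrarily large finite mass is almost surely nonempty (so infinitely many bubbles are added
  in [LSW] §7.2 as soon as `λ > 0`);
* NAMED FACT: `Literature.Probability.Process.exists_isPoissonCloud` — Kingman's **Existence
  Theorem** (§2.5): a non-atomic mean measure which is a countable sum of finite measures
  (Mathlib: `SFinite`) on a space with measurable diagonal is the mean measure of a Poisson
  process.

Mathlib: `ProbabilityTheory.poissonMeasure`, `ProbabilityTheory.iIndepFun`, `Set.encard`,
`ENat` with its (discrete) measurable structure; no point processes.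
-/

noncomputable section

open Set MeasureTheory ProbabilityTheory
open scoped ENNReal NNReal

namespace Literature.Probability.Process

variable {Ω E : Type*} [MeasurableSpace Ω] [MeasurableSpace E]

/-- **Poisson process (Poisson cloud) with mean measure `Λ`** (Kingman 1993, §2.1): a random
countable subset `X` of the state space, on the probability space `(Ω, P)`, such that the counts
`N(s) = #(X ∩ s)` (in `ℕ∞`) of measurable sets are random variables, "`N(A)` has the Poisson
distribution `𝒫(μ(A))`" — Poisson with mean `Λ s` when `Λ s < ∞`, and, with Kingman's
convention that `𝒫(∞)` is concentrated at `∞`, `N(s) = ∞` a.s. when `Λ s = ∞` — and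
`N(s₁), …, N(sₙ)` are independent for pairwise disjoint measurable `s₁, …, sₙ`.
[cite: Kingman1993, §2.1] -/
def IsPoissonCloud (Λ : Measure E) (X : Ω → Set E) (P : Measure Ω) : Prop :=
  IsProbabilityMeasure P ∧ (∀ ω, (X ω).Countable) ∧
    (∀ s, MeasurableSet s → Measurable fun ω ↦ (X ω ∩ s).encard) ∧
      (∀ s, MeasurableSet s → Λ s ≠ ∞ →
        P.map (fun ω ↦ (X ω ∩ s).encard) = (poissonMeasure (Λ s).toNNReal).map ((↑) : ℕ → ℕ∞)) ∧
        (∀ s, MeasurableSet s → Λ s = ∞ → ∀ᵐ ω ∂P, (X ω ∩ s).encard = ⊤) ∧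
          ∀ (n : ℕ) (s : Fin n → Set E), (∀ i, MeasurableSet (s i)) →
            Pairwise (Function.onFun Disjoint s) → iIndepFun (fun i ω ↦ (X ω ∩ s i).encard) P

namespace IsPoissonCloud

variable {Λ : Measure E} {X : Ω → Set E} {P : Measure Ω}

/-- A Poisson cloud lives on a probability space. [cite: Kingman1993, §2.1] -/
theorem isProbabilityMeasure (h : IsPoissonCloud Λ X P) : IsProbabilityMeasure P := h.1

/-- The cloud is a random COUNTABLE set. [cite: Kingman1993, §2.1] -/
theorem countable (h : IsPoissonCloud Λ X P) (ω : Ω) : (X ω).Countable := h.2.1 ω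

/-- The counts `N(s)` are random variables. [cite: Kingman1993, §2.1] -/
theorem measurable_encard (h : IsPoissonCloud Λ X P) {s : Set E} (hs : MeasurableSet s) :
    Measurable fun ω ↦ (X ω ∩ s).encard := h.2.2.1 s hs

/-- `N(s) ~ Poisson(Λ s)` for `Λ s < ∞`. [cite: Kingman1993, §2.1] -/
theorem map_encard (h : IsPoissonCloud Λ X P) {s : Set E} (hs : MeasurableSet s) (hΛ : Λ s ≠ ∞) :
    P.map (fun ω ↦ (X ω ∩ s).encard) = (poissonMeasure (Λ s).toNNReal).map ((↑) : ℕ → ℕ∞) :=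
  h.2.2.2.1 s hs hΛ

/-- `N(s) = ∞` a.s. for `Λ s = ∞` (Kingman's convention `𝒫(∞) = δ_∞`). [cite: Kingman1993, §2.1] -/
theorem ae_encard_eq_top (h : IsPoissonCloud Λ X P) {s : Set E} (hs : MeasurableSet s) (hΛ : Λ s = ∞) :
    ∀ᵐ ω ∂P, (X ω ∩ s).encard = ⊤ :=
  h.2.2.2.2.1 s hs hΛ

/-- Counts of pairwise disjoint measurable sets are independent. [cite: Kingman1993, §2.1] -/
theorem iIndepFun_encard (h : IsPoissonCloud Λ X P) {n : ℕ} {s : Fin n → Set E}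
    (hs : ∀ i, MeasurableSet (s i)) (hd : Pairwise (Function.onFun Disjoint s)) :
    iIndepFun (fun i ω ↦ (X ω ∩ s i).encard) P :=
  h.2.2.2.2.2 n s hs hd

omit [MeasurableSpace Ω] [MeasurableSpace E] in
/-- The avoidance event `{X ∩ s = ∅}` is the event `{N(s) = 0}`. [folklore] -/
theorem setOf_inter_eq_empty (X : Ω → Set E) (s : Set E) :
    {ω | X ω ∩ s = ∅} = (fun ω ↦ (X ω ∩ s).encard) ⁻¹' {0} := by
  ext ω
  simp

/-- The avoidance events are measurable. [folklore] -/
theorem measurableSet_inter_eq_empty (h : IsPoissonCloud Λ X P) {s : Set E} (hs : MeasurableSet s) :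
    MeasurableSet {ω | X ω ∩ s = ∅} := by
  rw [setOf_inter_eq_empty]
  exact h.measurable_encard hs (measurableSet_singleton 0)

/-- **Avoidance probabilities of a Poisson cloud** (Kingman 1993, §2.1: `P{N(A) = 0} = e^{−μ(A)}`):
for measurable `s` with `Λ s < ∞`, `P[X ∩ s = ∅] = e^{−Λ s}`. [cite: Kingman1993, §2.1] -/
theorem measure_inter_eq_empty (h : IsPoissonCloud Λ X P) {s : Set E} (hs : MeasurableSet s)
    (hΛ : Λ s ≠ ∞) : P {ω | X ω ∩ s = ∅} = ENNReal.ofReal (Real.exp (-(Λ s).toReal)) := by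
  rw [setOf_inter_eq_empty, ← Measure.map_apply (h.measurable_encard hs) (measurableSet_singleton 0),
    h.map_encard hs hΛ, Measure.map_apply measurable_from_top (measurableSet_singleton 0)]
  have hpre : ((↑) : ℕ → ℕ∞) ⁻¹' {0} = {0} := by
    ext n
    simp
  rw [hpre, poissonMeasure_singleton]
  simp [ENNReal.toReal]

/-- **A cloud with unbounded finite masses is almost surely nonempty**: if `Λ` has measurable
sets of arbitrarily large finite mass (e.g. `Λ` s-finite with `Λ(E) = ∞`), then `P[X = ∅] = 0`
(`P[X = ∅] ≤ P[X ∩ s = ∅] = e^{−Λ s}` for every such `s`). [cite: Kingman1993, §2.1] -/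
theorem measure_eq_empty_eq_zero (h : IsPoissonCloud Λ X P)
    (hΛ : ∀ r : ℝ, ∃ s, MeasurableSet s ∧ Λ s ≠ ∞ ∧ r ≤ (Λ s).toReal) :
    P {ω | X ω = ∅} = 0 := by
  refine le_antisymm (ENNReal.le_of_forall_pos_le_add fun ε hε _ ↦ ?_) bot_le
  -- choose `s` with `e^{-Λ s} ≤ ε`
  obtain ⟨s, hs, hfin, hr⟩ := hΛ (-Real.log ε)
  calc P {ω | X ω = ∅} ≤ P {ω | X ω ∩ s = ∅} := measure_mono fun ω (hω : X ω = ∅) ↦ by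
          show X ω ∩ s = ∅
          rw [hω, empty_inter]
    _ = ENNReal.ofReal (Real.exp (-(Λ s).toReal)) := h.measure_inter_eq_empty hs hfin
    _ ≤ ENNReal.ofReal ε := by
          refine ENNReal.ofReal_le_ofReal ?_
          have : Real.exp (-(Λ s).toReal) ≤ Real.exp (Real.log ε) := Real.exp_le_exp.2 (by linarith)
          rwa [Real.exp_log (by exact_mod_cast hε)] at this
    _ = (ε : ℝ≥0∞) := ENNReal.ofReal_coe_nnreal
    _ ≤ 0 + ε := by rw [zero_add]

/-- Almost surely the cloud is nonempty (a.e. form of `measure_eq_empty_eq_zero`). [cite: Kingman1993, §2.1] -/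
theorem ae_nonempty (h : IsPoissonCloud Λ X P)
    (hΛ : ∀ r : ℝ, ∃ s, MeasurableSet s ∧ Λ s ≠ ∞ ∧ r ≤ (Λ s).toReal) :
    ∀ᵐ ω ∂P, (X ω).Nonempty := by
  rw [ae_iff]
  have : {ω | ¬ (X ω).Nonempty} = {ω | X ω = ∅} := by
    ext ω
    simp [not_nonempty_iff_eq_empty]
  rw [this]
  exact h.measure_eq_empty_eq_zero hΛ

/-- **A cloud with infinite total mean is almost surely infinite** (in particular nonempty):
`N(E) = ∞` a.s. when `Λ(E) = ∞`. [cite: Kingman1993, §2.1] -/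
theorem ae_infinite (h : IsPoissonCloud Λ X P) (hΛ : Λ univ = ∞) : ∀ᵐ ω ∂P, (X ω).Infinite := by
  filter_upwards [h.ae_encard_eq_top MeasurableSet.univ hΛ] with ω hω
  rw [inter_univ] at hω
  exact encard_eq_top_iff.1 hω

/-- A cloud with infinite total mean is almost surely nonempty. [cite: Kingman1993, §2.1] -/
theorem ae_nonempty_of_measure_univ (h : IsPoissonCloud Λ X P) (hΛ : Λ univ = ∞) :
    ∀ᵐ ω ∂P, (X ω).Nonempty :=
  (h.ae_infinite hΛ).mono fun _ hω ↦ hω.nonempty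

end IsPoissonCloud

/-- NAMED FACT — **Kingman's Existence Theorem** (Kingman 1993, §2.5): "Let `μ` be a non-atomic
measure on `S` which can be expressed in the form `μ = Σₙ μₙ`, `μₙ(S) < ∞`. Then there exists a
Poisson process `Π` on `S` having `μ` as its mean measure." Here: for a measurable space `E`
whose diagonal is measurable (Kingman's standing assumption of §2.1–2.2, under which "random
countable set" and its counts behave; it holds for countably separated spaces), every s-finite
(`SFinite`: a countable sum of finite measures) measure `Λ` without atoms is the mean measure of
a Poisson cloud on some probability space. (Proof there: superpose, over `n`, `𝒫(μₙ(S))`-many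
independent points of law `μₙ/μₙ(S)`.) [cite: Kingman1993, §2.5 Existence Theorem] -/
def exists_isPoissonCloud.{u} : Prop :=
  ∀ {E : Type u} [MeasurableSpace E] (Λ : Measure E), MeasurableSet (Set.diagonal E) → SFinite Λ →
    (∀ x : E, Λ {x} = 0) →
      ∃ (Ω : Type u) (_ : MeasurableSpace Ω) (P : Measure Ω) (X : Ω → Set E), IsPoissonCloud Λ X P

end Literature.Probability.Process

end
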